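import Summits.NavierStokesRegularity.NavierStokesRegularity.Theorems.HodographBetchovFastClassSqueezeNoConcentration

/-!
# `FastClassSqueeze` (stmt-NavierStokesRegularity-15832) follows from the fast-class SUP squeeze

Route `HodographBetchov`, crux 3; idea card `Cruxes/FastClassSqueeze/Ideas/chebyshev-sup-transfer.md`
(crux-ideate r1 k2), its transfer step `SupSqueezeTransfer`, PROVED.

`fastClassSqueeze_of_supSqueeze`: suppose that along every classical solution of unforced
Navier–Stokes on `ℝ³ × [0,T)` that is Leray–Hopf from a rapidly decaying datum there are a level
`l > 0`, an exponent `r > 1` and a TIME-ONLY nonnegative majorant `M(t)` of the middle strain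
eigenvalue on the fast class `{|u(t)| > l}` (min–max form) with `∫₀ᵀ M(t)^r dt < ∞`.  Then
`FastClassSqueeze` holds with the same `l`, `q := 3r/(2r−2) > 3/2` and `m(t,x) := M(t)`: the inner
integral is `M(t)^q |{|u(t)|>l}| ≤ M(t)^q · 2E(u₀)/l²` (Chebyshev on the energy class,
`Birth.volume_fast_le` — the one place the Leray–Hopf hypothesis enters, exactly as the Negative lemma
`fastClassSqueeze_false_without_lerayHopf` demands), and the exponents are rigged so that
`2/(2q−3) = 2(r−1)/3` and `q · 2/(2q−3) = r`: the mixed norm is `(2E(u₀)/l²)^{2(r−1)/3} ∫₀ᵀ M^r < ∞`.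
So the crux reduces to a one-dimensional statement: `t ↦ sup_{|u(t)|>l} λ₂⁺ ∈ L^r(0,T)` for some
`l > 0`, `r > 1` (Chae 2005 / Miller 2019 `q = ∞` endpoint, a priori, on the fast class, with room in
time).
-/

noncomputable section

-- the summit and its single problem share the name `NavierStokesRegularity` (D-0017 nested layout)
set_option linter.dupNamespace false

namespace Summit.NavierStokesRegularity.NavierStokesRegularity.Theorems.FastClassSqueeze.SupTransfer

open Set MeasureTheory Filter Topology Literature.Analysis.FluidPDE
open scoped ENNReal NNReal

/-- Exponent bookkeeping of the sup transfer: for `r > 1` and `q = 3r/(2r−2)` one has `q > 3/2`,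
`2/(2q−3) = 2(r−1)/3` and `q · (2/(2q−3)) = r`. [folklore] -/
theorem sup_exponents {r : ℝ} (hr : 1 < r) :
    3 / 2 < 3 * r / (2 * r - 2) ∧ 2 / (2 * (3 * r / (2 * r - 2)) - 3) = 2 * (r - 1) / 3 ∧
      3 * r / (2 * r - 2) * (2 / (2 * (3 * r / (2 * r - 2)) - 3)) = r := by
  have h1 : 0 < 2 * r - 2 := by linarith
  have h2 : 2 * r - 2 ≠ 0 := h1.ne'
  have hq : 2 * (3 * r / (2 * r - 2)) - 3 = 6 / (2 * r - 2) := by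
    rw [eq_div_iff h2, sub_mul, mul_assoc, div_mul_cancel₀ _ h2]
    ring
  refine ⟨?_, ?_, ?_⟩
  · rw [div_lt_div_iff₀ two_pos h1]; linarith
  · rw [hq, div_div_eq_mul_div]; ring
  · rw [hq, div_div_eq_mul_div, div_mul_div_comm, div_eq_iff (mul_ne_zero h2 (by norm_num))]
    ring

/-- **`FastClassSqueeze` from the fast-class sup squeeze** (card `chebyshev-sup-transfer`,
`SupSqueezeTransfer`).  If along every classical Leray–Hopf solution from a rapidly decaying datum on
`[0,T)` some level `l > 0`, exponent `r > 1` and time-only nonnegative min–max majorant `M(t)` of the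
middle strain eigenvalue on `{|u(t)| > l}` satisfy `∫₀ᵀ M^r < ∞`, then `FastClassSqueeze` holds
(`q = 3r/(2r−2)`, `m(t,x) = M(t)`; inner integral `≤ M(t)^q · 2E(u₀)/l²` by Chebyshev on the energy
class, `(M^q V)^{2/(2q−3)} = M^r V^{2(r−1)/3}`). [cite: Leray1934, (5.2)] -/
theorem fastClassSqueeze_of_supSqueeze :
    (∀ (ν T : ℝ), 0 < ν → 0 < T →
      ∀ (u : ℝ → EuclideanSpace ℝ (Fin 3) → EuclideanSpace ℝ (Fin 3))
        (p : ℝ → EuclideanSpace ℝ (Fin 3) → ℝ),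
        Literature.Analysis.FluidPDE.IsClassicalNSSolutionOn (Set.Ico 0 T) ν 0 u p →
        Literature.Analysis.FluidPDE.IsLerayHopfOn T ν 0 (u 0) u →
        Literature.Analysis.FluidPDE.HasRapidSpatialDecay (u 0) →
        ∃ l : ℝ, 0 < l ∧ ∃ r : ℝ, 1 < r ∧ ∃ M : ℝ → ℝ, (∀ t, 0 ≤ M t) ∧
          (∀ t ∈ Set.Ico 0 T, ∀ x, l < ‖u t x‖ → ∃ v w : EuclideanSpace ℝ (Fin 3),
            ‖v‖ = 1 ∧ ‖w‖ = 1 ∧ inner ℝ v w = 0 ∧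
            ∀ α β : ℝ, inner ℝ (fderiv ℝ (u t) x (α • v + β • w)) (α • v + β • w) ≤
              M t * (α ^ 2 + β ^ 2)) ∧
          ∫⁻ t in Set.Ioo 0 T, ENNReal.ofReal (M t) ^ r < ⊤) →
    Summit.NavierStokesRegularity.NavierStokesRegularity.Theses.HodographBetchov.FastClassSqueeze := by
  intro hsup ν T hν hT u p hcl hLH hdec
  obtain ⟨l, hl, r, hr, M, hM0, hclause, hint⟩ := hsup ν T hν hT u p hcl hLH hdec
  obtain ⟨hq32, hexp, hqr⟩ := sup_exponents hr
  set q : ℝ := 3 * r / (2 * r - 2) with hq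
  have hq0 : 0 ≤ q := by linarith
  have hρ0 : 0 ≤ 2 * (r - 1) / 3 := by nlinarith
  set Vl : ℝ≥0∞ := ENNReal.ofReal (2 * VectorCalculus.kineticEnergy (u 0) / l ^ 2) with hVl
  refine ⟨l, hl, q, hq32, fun t _ => M t, fun t _ => hM0 t, ?_, ?_⟩
  · intro t ht x hx
    exact hclause t ht x hx
  · -- pointwise in `t ∈ (0,T)`: `(∫_{F} M^q)^{2/(2q-3)} ≤ M^r · Vl^{2(r-1)/3}`
    have hpt : ∀ t ∈ Ioo 0 T,
        (∫⁻ x in {x : EuclideanSpace ℝ (Fin 3) | l < ‖u t x‖}, ENNReal.ofReal (M t) ^ q) ^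
            (2 / (2 * q - 3)) ≤
          ENNReal.ofReal (M t) ^ r * Vl ^ (2 * (r - 1) / 3) := by
      intro t ht
      have hvol : volume {x : EuclideanSpace ℝ (Fin 3) | l < ‖u t x‖} ≤ Vl :=
        Birth.volume_fast_le hν.le hLH ⟨ht.1.le, ht.2.le⟩
          (hcl.contDiff_velocity (Ioo_subset_Ico_self ht)).continuous.measurable.aemeasurable hl
      rw [setLIntegral_const, hexp]
      calc (ENNReal.ofReal (M t) ^ q * volume {x : EuclideanSpace ℝ (Fin 3) | l < ‖u t x‖}) ^
            (2 * (r - 1) / 3)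
          ≤ (ENNReal.ofReal (M t) ^ q * Vl) ^ (2 * (r - 1) / 3) := by gcongr
        _ = ENNReal.ofReal (M t) ^ r * Vl ^ (2 * (r - 1) / 3) := by
            rw [ENNReal.mul_rpow_of_nonneg _ _ hρ0, ← ENNReal.rpow_mul, ← hexp, hqr]
    have hle : ∫⁻ t in Ioo 0 T,
          (∫⁻ x in {x : EuclideanSpace ℝ (Fin 3) | l < ‖u t x‖}, ENNReal.ofReal (M t) ^ q) ^
            (2 / (2 * q - 3)) ≤
        ∫⁻ t in Ioo 0 T, ENNReal.ofReal (M t) ^ r * Vl ^ (2 * (r - 1) / 3) := by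
      refine lintegral_mono_ae ?_
      filter_upwards [ae_restrict_mem measurableSet_Ioo] with t ht
      exact hpt t ht
    refine lt_of_le_of_lt hle ?_
    rw [lintegral_mul_const' _ _ (ENNReal.rpow_ne_top_of_nonneg hρ0 ENNReal.ofReal_ne_top)]
    exact ENNReal.mul_lt_top hint
      (ENNReal.rpow_ne_top_of_nonneg hρ0 ENNReal.ofReal_ne_top).lt_top

end Summit.NavierStokesRegularity.NavierStokesRegularity.Theorems.FastClassSqueeze.SupTransfer

end
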